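import Summits.CriticalPhenomena.PercolationContinuityZ3.Theorems.PercNearOneGluingNoHeavyPcintKernZ5B4Defs
import HarnessLib

/-!
# PCINT lane, kernel check 2/2 of the B3r window certificate `d = 5`, memory 4 (3-step windows, 1000 codes): codes `500 ≤ c < 1000`

Cell `prim-pcint`, seat `prim-pcint-2` (gen 2).  Collatz–Wielandt rows `10^5 · row ≤ 99999 · DEN · v` for the window codes in
`[500, 1000)`, by `decide +kernel` in chunks of `50` codes (natural-number arithmetic only; `maxHeartbeats 0`).
Does NOT build on p205010.
-/

namespace Summit.CriticalPhenomena.PercolationContinuityZ3.Theorems.Pcint.Z5B4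

set_option maxHeartbeats 0 in
/-- Rows `500 ≤ c < 550` of the certificate hold. [folklore] -/
theorem chk_500_550 : WinK.allRange (WinK.rowOKB 5 2 1136 10065 9936 99999 tbl 88354) 500 550 = true := by decide +kernel

set_option maxHeartbeats 0 in
/-- Rows `550 ≤ c < 600` of the certificate hold. [folklore] -/
theorem chk_550_600 : WinK.allRange (WinK.rowOKB 5 2 1136 10065 9936 99999 tbl 88354) 550 600 = true := by decide +kernel

set_option maxHeartbeats 0 in
/-- Rows `600 ≤ c < 650` of the certificate hold. [folklore] -/
theorem chk_600_650 : WinK.allRange (WinK.rowOKB 5 2 1136 10065 9936 99999 tbl 88354) 600 650 = true := by decide +kernel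

set_option maxHeartbeats 0 in
/-- Rows `650 ≤ c < 700` of the certificate hold. [folklore] -/
theorem chk_650_700 : WinK.allRange (WinK.rowOKB 5 2 1136 10065 9936 99999 tbl 88354) 650 700 = true := by decide +kernel

set_option maxHeartbeats 0 in
/-- Rows `700 ≤ c < 750` of the certificate hold. [folklore] -/
theorem chk_700_750 : WinK.allRange (WinK.rowOKB 5 2 1136 10065 9936 99999 tbl 88354) 700 750 = true := by decide +kernel

set_option maxHeartbeats 0 in
/-- Rows `750 ≤ c < 800` of the certificate hold. [folklore] -/
theorem chk_750_800 : WinK.allRange (WinK.rowOKB 5 2 1136 10065 9936 99999 tbl 88354) 750 800 = true := by decide +kernel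

set_option maxHeartbeats 0 in
/-- Rows `800 ≤ c < 850` of the certificate hold. [folklore] -/
theorem chk_800_850 : WinK.allRange (WinK.rowOKB 5 2 1136 10065 9936 99999 tbl 88354) 800 850 = true := by decide +kernel

set_option maxHeartbeats 0 in
/-- Rows `850 ≤ c < 900` of the certificate hold. [folklore] -/
theorem chk_850_900 : WinK.allRange (WinK.rowOKB 5 2 1136 10065 9936 99999 tbl 88354) 850 900 = true := by decide +kernel

set_option maxHeartbeats 0 in
/-- Rows `900 ≤ c < 950` of the certificate hold. [folklore] -/
theorem chk_900_950 : WinK.allRange (WinK.rowOKB 5 2 1136 10065 9936 99999 tbl 88354) 900 950 = true := by decide +kernel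

set_option maxHeartbeats 0 in
/-- Rows `950 ≤ c < 1000` of the certificate hold. [folklore] -/
theorem chk_950_1000 : WinK.allRange (WinK.rowOKB 5 2 1136 10065 9936 99999 tbl 88354) 950 1000 = true := by decide +kernel

/-- Rows `500 ≤ c < 1000` of the certificate hold. [folklore] -/
theorem chkFile_2 : WinK.allRange (WinK.rowOKB 5 2 1136 10065 9936 99999 tbl 88354) 500 1000 = true :=
  chk_split (chk_split (chk_split (chk_split (chk_split (chk_split (chk_split (chk_split (chk_split chk_500_550 chk_550_600) chk_600_650) chk_650_700) chk_700_750) chk_750_800) chk_800_850) chk_850_900) chk_900_950) chk_950_1000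

end Summit.CriticalPhenomena.PercolationContinuityZ3.Theorems.Pcint.Z5B4
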